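import Mathlib
import Literature.Analysis.FluidPDE.SpaceTimeRescaling
import Literature.Analysis.FluidPDE.SuitableWeakExhaustion
import Literature.Analysis.FluidPDE.SuitableWeakCongr
import Literature.Analysis.FluidPDE.SelfSimilarCollapseAnsatz
import HarnessLib

/-!
# Exactly self-similar members about a SHIFTED blow-up point: the origin-centred extension
# (crux `EulerZoomLiouville.PowerGaugeEulerLiouville` = stmt-NavierStokesRegularity-19832, line `birth`, rung C1)

Route `EulerZoomLiouville` (NavierStokesRegularity).  A member of crux E's class is a distributional Euler pair
`(u, p)` on the slab `(−∞,0) × ℝ³` (`ν = 0`, `f = 0`).  The lineage's self-similar strata are stated for members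
that are exactly self-similar ABOUT THE SPACE–TIME ORIGIN, `u(τ) = selfSimilarCollapse γ 0 V τ`; a member that is
exactly self-similar about another point — blow-up time `T ≥ 0`, centre `x₀` —,
`u(τ, x) = (T − τ)^{γ−1} V((T − τ)^{−γ}(x − x₀))`, `p(τ, x) = (T − τ)^{2(γ−1)} P((T − τ)^{−γ}(x − x₀))` (`τ < 0`),
is currently filed under `stub_nonSelfSimilarRest` (RESIDUE-MEMO-19832-g8 §1).  MAIN THEOREM:

* `Shifted.isDistributional_selfSimilarCollapse_of_shifted` — for such a member, the ORIGIN-CENTRED EXTENSION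
  `ũ := selfSimilarCollapse γ 0 V`, `p̃ := selfSimilarCollapsePressure γ 0 P` (same profile, blow-up point `(0,0)`,
  defined for all `τ < 0`) is again a distributional Euler pair on the whole slab `(−∞,0) × ℝ³`.

Proof: for `b < 0` put `β := T/(−b) + 1`, `λ := β^γ`, `α := β^{1−γ}` (`β = αλ`); the space–time affine covariance
of distributional solutions (`IsDistributionalNSSolutionOn.stRescale`, map `(s,y) ↦ (T + βs, x₀ + λy)`, weights
`α`, `α²`, viscosity `α·0/λ = 0`) produces a distributional pair on the preimage slab `(−∞, −T/β) ⊇ (−∞, b)`, which by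
the member's own similarity coincides there with `(ũ, p̃)` POINTWISE (`αβ^{γ−1} = 1`, `β^{−γ}λ = 1`,
`α²β^{2(γ−1)} = 1`); distributional solutions are local in time (`IsDistributionalNSSolutionOn.of_exhaustion` along
the slabs `(−∞, −1/(n+1))`), whence the pair on `(−∞, 0)`.

WHY THIS IS NOT BOOKKEEPING: the class gauges are centred at the PHYSICAL origin, so for `T > 0` they constrain the
profile only at large profile scales; the extension `ũ` need not satisfy the class's small-scale gauge bounds (it is
NOT claimed to be a class member) — only its Euler identity is transported, which is all the profile theorems
(`ProfileEquation.weak_profile_equation`, `WeakToClassical.exists_isSelfSimilarEulerProfile_of_contDiff`) consume.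
WHAT THIS IS NOT: not NS, not E — a dictionary entry `--supports` stmt-19832; used by `…SelfSimilarShiftedBoundedC2`.
[folklore]
-/

noncomputable section

-- flat `Theorems/<Route><Decl>…` files of one crux share the namespace of the crux (tree convention: `Summit.<S>.<S>.…`)
set_option linter.dupNamespace false

open MeasureTheory Set Filter Topology Metric Function TopologicalSpace
open scoped ENNReal NNReal

namespace Summit.NavierStokesRegularity.NavierStokesRegularity.Theorems.PowerGaugeEulerLiouville

open Literature.Analysis Literature.Analysis.FluidPDE

namespace Shifted

/-! ### Distributional Euler pairs are local in time on the slab -/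

/-- A compact subset of the open slab `(−∞,0) × ℝ³` lies in a slab `(−∞, −1/(n+1)) × ℝ³` (its time projection is
compact, hence has a largest element, which is negative). [folklore] -/
theorem exists_subset_slab_Iio_neg_of_isCompact {K : Set (ℝ × EuclideanSpace ℝ (Fin 3))}
    (hK : K ⊆ ((slab (EuclideanSpace ℝ (Fin 3)) (Iio 0) isOpen_Iio : Opens (ℝ × EuclideanSpace ℝ (Fin 3))) :
      Set (ℝ × EuclideanSpace ℝ (Fin 3))))
    (hKc : IsCompact K) :
    ∃ n : ℕ, K ⊆ ((slab (EuclideanSpace ℝ (Fin 3)) (Iio (-(1 / ((n : ℝ) + 1)))) isOpen_Iio :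
      Opens (ℝ × EuclideanSpace ℝ (Fin 3))) : Set (ℝ × EuclideanSpace ℝ (Fin 3))) := by
  rcases K.eq_empty_or_nonempty with h | hne
  · exact ⟨0, by rw [h]; exact empty_subset _⟩
  · have hc : IsCompact (Prod.fst '' K) := hKc.image continuous_fst
    obtain ⟨t, ht, htup⟩ := hc.exists_isGreatest (hne.image _)
    have ht0 : t < 0 := by
      obtain ⟨z, hz, rfl⟩ := ht
      have hz' := hK hz
      rw [SetLike.mem_coe, mem_slab] at hz'
      exact hz'
    obtain ⟨n, hn⟩ := exists_nat_one_div_lt (neg_pos.2 ht0)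
    refine ⟨n, fun z hz => ?_⟩
    rw [SetLike.mem_coe, mem_slab, mem_Iio]
    have h1 : z.1 ≤ t := htup (mem_image_of_mem _ hz)
    linarith

/-- **Distributional Navier–Stokes/Euler pairs are local in time:** a pair that is a distributional solution on every
slab `(−∞, b) × ℝ³`, `b < 0`, is one on `(−∞, 0) × ℝ³` (`IsDistributionalNSSolutionOn.of_exhaustion` along the slabs
`(−∞, −1/(n+1))`; Caffarelli–Kohn–Nirenberg 1982, §2: the conditions are local). [folklore] -/
theorem isDistributional_slab_Iio_zero_of_forall {ν : ℝ}
    {f u : ℝ → EuclideanSpace ℝ (Fin 3) → EuclideanSpace ℝ (Fin 3)} {p : ℝ → EuclideanSpace ℝ (Fin 3) → ℝ}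
    (h : ∀ b : ℝ, b < 0 →
      IsDistributionalNSSolutionOn (slab (EuclideanSpace ℝ (Fin 3)) (Iio b) isOpen_Iio) ν f u p) :
    IsDistributionalNSSolutionOn (slab (EuclideanSpace ℝ (Fin 3)) (Iio 0) isOpen_Iio) ν f u p := by
  refine IsDistributionalNSSolutionOn.of_exhaustion
    (Qn := fun n : ℕ => slab (EuclideanSpace ℝ (Fin 3)) (Iio (-(1 / ((n : ℝ) + 1)))) isOpen_Iio)
    (fun n => slab_mono (Iio_subset_Iio ?_)) (fun K hK hKc => exists_subset_slab_Iio_neg_of_isCompact hK hKc)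
    (fun n => h _ ?_)
  · have : (0 : ℝ) < 1 / ((n : ℝ) + 1) := by positivity
    linarith
  · have : (0 : ℝ) < 1 / ((n : ℝ) + 1) := by positivity
    linarith

/-! ### The origin-centred extension of a shifted exactly self-similar member -/

/-- Exponent bookkeeping of the similarity scaling: `β^{1−γ} (β s)^{γ−1} = s^{γ−1}` (`β, s > 0`). [folklore] -/
theorem rpow_one_sub_mul_mul_rpow {β s γ : ℝ} (hβ : 0 < β) (hs : 0 < s) :
    β ^ (1 - γ) * (β * s) ^ (γ - 1) = s ^ (γ - 1) := by
  rw [Real.mul_rpow hβ.le hs.le, ← mul_assoc, ← Real.rpow_add hβ,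
    show (1 - γ) + (γ - 1) = 0 by ring, Real.rpow_zero, one_mul]

/-- Exponent bookkeeping of the similarity scaling: `(β s)^{−γ} β^{γ} = s^{−γ}` (`β, s > 0`). [folklore] -/
theorem mul_rpow_neg_mul_rpow {β s γ : ℝ} (hβ : 0 < β) (hs : 0 < s) :
    (β * s) ^ (-γ) * β ^ γ = s ^ (-γ) := by
  rw [Real.mul_rpow hβ.le hs.le, mul_comm, ← mul_assoc, ← Real.rpow_add hβ,
    show γ + -γ = 0 by ring, Real.rpow_zero, one_mul]

/-- Exponent bookkeeping of the similarity scaling (pressure): `(β^{1−γ})² (β s)^{2(γ−1)} = s^{2(γ−1)}`. [folklore] -/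
theorem rpow_one_sub_sq_mul_mul_rpow {β s γ : ℝ} (hβ : 0 < β) (hs : 0 < s) :
    (β ^ (1 - γ)) ^ 2 * (β * s) ^ (2 * (γ - 1)) = s ^ (2 * (γ - 1)) := by
  rw [Real.mul_rpow hβ.le hs.le, ← mul_assoc, sq, ← Real.rpow_add hβ, ← Real.rpow_add hβ,
    show (1 - γ) + (1 - γ) + 2 * (γ - 1) = 0 by ring, Real.rpow_zero, one_mul]

/-- **THE ORIGIN-CENTRED EXTENSION OF A SHIFTED EXACTLY SELF-SIMILAR MEMBER IS A DISTRIBUTIONAL EULER PAIR ON THE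
WHOLE SLAB.**  Let `(u, p)` be a distributional Euler pair on `(−∞,0) × ℝ³` which is exactly self-similar about the
space–time point `(T, x₀)`, `T ≥ 0`, with exponent `γ` and profile `(V, P)`:
`u(τ, x) = (T−τ)^{γ−1} V((T−τ)^{−γ}(x − x₀))`, `p(τ, x) = (T−τ)^{2(γ−1)} P((T−τ)^{−γ}(x − x₀))` for `τ < 0`.  Then
`(selfSimilarCollapse γ 0 V, selfSimilarCollapsePressure γ 0 P)` — the same profile blown up at the origin — is a
distributional Euler pair on `(−∞,0) × ℝ³`.  (Translation + similarity scaling + locality in time; see the module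
docstring.) [folklore] -/
theorem isDistributional_selfSimilarCollapse_of_shifted {γ : ℝ} {T : ℝ} (hT : 0 ≤ T)
    (x₀ : EuclideanSpace ℝ (Fin 3))
    {u : ℝ → EuclideanSpace ℝ (Fin 3) → EuclideanSpace ℝ (Fin 3)} {p : ℝ → EuclideanSpace ℝ (Fin 3) → ℝ}
    (hsol : IsDistributionalNSSolutionOn (slab (EuclideanSpace ℝ (Fin 3)) (Iio 0) isOpen_Iio) 0 0 u p)
    {V : EuclideanSpace ℝ (Fin 3) → EuclideanSpace ℝ (Fin 3)} {P : EuclideanSpace ℝ (Fin 3) → ℝ}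
    (hu : ∀ τ : ℝ, τ < 0 → u τ = fun x => selfSimilarCollapse γ T V τ (x - x₀))
    (hp : ∀ τ : ℝ, τ < 0 → p τ = fun x => selfSimilarCollapsePressure γ T P τ (x - x₀)) :
    IsDistributionalNSSolutionOn (slab (EuclideanSpace ℝ (Fin 3)) (Iio 0) isOpen_Iio) 0 0
      (selfSimilarCollapse γ 0 V) (selfSimilarCollapsePressure γ 0 P) := by
  refine isDistributional_slab_Iio_zero_of_forall fun b hb => ?_
  -- ### the similarity scaling that brings the blow-up time below `b`
  have hb' : 0 < -b := neg_pos.2 hb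
  set β : ℝ := T / (-b) + 1 with hβdef
  have hβ : 0 < β := by
    have : 0 ≤ T / (-b) := div_nonneg hT hb'.le
    rw [hβdef]; linarith
  set lam : ℝ := β ^ γ with hlamdef
  set α : ℝ := β ^ (1 - γ) with hαdef
  have hlam : 0 < lam := Real.rpow_pos_of_pos hβ _
  have hα : 0 < α := Real.rpow_pos_of_pos hβ _
  have hαβ : β = α * lam := by
    rw [hαdef, hlamdef, ← Real.rpow_add hβ, show (1 - γ) + γ = 1 by ring, Real.rpow_one]
  -- ### covariance
  have h1 := hsol.stRescale hα hlam hαβ T x₀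
  have hf0 : ((α ^ 2 * lam) • stPull β lam T x₀ (0 : ℝ → EuclideanSpace ℝ (Fin 3) → EuclideanSpace ℝ (Fin 3))) = 0 := by
    funext s y
    simp [stPull]
  rw [mul_zero, zero_div, hf0] at h1
  -- ### restriction to the slab `(−∞, b)`
  have hβb : β * b = -T + b := by
    rw [hβdef, add_mul, one_mul, div_neg, neg_mul, div_mul_cancel₀ T hb.ne]
  have hle : slab (EuclideanSpace ℝ (Fin 3)) (Iio b) isOpen_Iio ≤
      stPreimage β lam T x₀ (slab (EuclideanSpace ℝ (Fin 3)) (Iio 0) isOpen_Iio) := by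
    intro z hz
    rw [mem_stPreimage, mem_slab, stAffine_fst, mem_Iio]
    rw [mem_slab, mem_Iio] at hz
    have : β * z.1 < β * b := mul_lt_mul_of_pos_left hz hβ
    linarith
  have h2 := h1.of_le hle
  -- ### on `(−∞, b)` the rescaled pair IS the origin-centred collapse of the same profile
  have hmeas : MeasurableSet (((slab (EuclideanSpace ℝ (Fin 3)) (Iio b) isOpen_Iio :
      Opens (ℝ × EuclideanSpace ℝ (Fin 3))) : Set (ℝ × EuclideanSpace ℝ (Fin 3)))) :=
    (slab (EuclideanSpace ℝ (Fin 3)) (Iio b) isOpen_Iio).isOpen.measurableSet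
  have htime : ∀ z : ℝ × EuclideanSpace ℝ (Fin 3),
      z ∈ (((slab (EuclideanSpace ℝ (Fin 3)) (Iio b) isOpen_Iio : Opens (ℝ × EuclideanSpace ℝ (Fin 3))) :
        Set (ℝ × EuclideanSpace ℝ (Fin 3)))) → T + β * z.1 < 0 ∧ 0 < -z.1 := by
    intro z hz
    rw [SetLike.mem_coe, mem_slab, mem_Iio] at hz
    have : β * z.1 < β * b := mul_lt_mul_of_pos_left hz hβ
    exact ⟨by linarith, by linarith⟩
  refine h2.congr_ae ((ae_restrict_iff' hmeas).2 (ae_of_all _ fun z hz => ?_))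
    ((ae_restrict_iff' hmeas).2 (ae_of_all _ fun z hz => ?_))
  · obtain ⟨hτ, hs⟩ := htime z hz
    show (α • stPull β lam T x₀ u) z.1 z.2 = selfSimilarCollapse γ 0 V z.1 z.2
    rw [smul_stPull_apply, hu _ hτ]
    simp only [selfSimilarCollapse_apply, add_sub_cancel_left, zero_sub, smul_smul]
    rw [show T - (T + β * z.1) = β * (-z.1) by ring, rpow_one_sub_mul_mul_rpow hβ hs,
      mul_rpow_neg_mul_rpow hβ hs]
  · obtain ⟨hτ, hs⟩ := htime z hz
    show (α ^ 2 • stPull β lam T x₀ p) z.1 z.2 = selfSimilarCollapsePressure γ 0 P z.1 z.2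
    rw [smul_stPull_apply, hp _ hτ]
    simp only [selfSimilarCollapsePressure_apply, add_sub_cancel_left, zero_sub, smul_smul, smul_eq_mul]
    rw [show T - (T + β * z.1) = β * (-z.1) by ring, ← mul_assoc, rpow_one_sub_sq_mul_mul_rpow hβ hs,
      mul_rpow_neg_mul_rpow hβ hs]

end Shifted

end Summit.NavierStokesRegularity.NavierStokesRegularity.Theorems.PowerGaugeEulerLiouville

end
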